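import Summits.Langlands.Langlands.Theses.ClassicalCongruenceSplit
import Literature.NumberTheory.Automorphic.ResGLnCohomologyFiniteDimensional
import Literature.NumberTheory.Automorphic.BorelSerreCohomologyFiniteness
import Literature.NumberTheory.Automorphic.ResGLnCohomologyHeckeCommute
import Literature.NumberTheory.Automorphic.ResGLnCohomologyRationalRelationsProofs
import Literature.Algebra.Module.DeligneSerreLifting
import HarnessLib

/-!
# The classical congruence junction (Deligne–Serre lifting lemma) — proved

[proof of `Summit.Langlands.Langlands.Theses.ClassicalCongruenceSplit.ClassicalCongruenceJunction`
(route `ClassicalCongruenceSplit`, support item, binder `hC` of its deciding theorem `closes`)]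
Proved outright from three tree theorems: finite-dimensionality of the receptacles
(`finiteDimensional_levelCohomology_of_borelSerre'` + the proved Borel–Serre fact
`BorelSerre1973_finiteDimensional_groupCohomology_congruenceSubgroup_holds`), the rational-structure
input `heckeRelations_definedOverInt_holds` (integral non-commutative relations among good Hecke
operators are `𝒪`-combinations of `ℤ`-relations), and their commutativity `heckeT_comm`.

**Proof.** `L = ℚ̄_p`, `𝒪` its valuation ring, `κ` the residue field, `M_k` the receptacles,
`E = Π_k End_L(M_k)`, `Λ` the good letters `(v, i)` (`v ∉ S`, `v ∤ 𝔫`); the Hecke operators form a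
commuting family `T : Λ → E` generating a commutative finite-dimensional subalgebra `A ⊆ E`
(applied below with `N := A`, on which `A` acts faithfully).
1. *Key transfer* (`classicalCongruenceJunction`, `hkey`): if `x ∈ 𝒪[X_Λ]` vanishes at `T` then
   `x̄(f) = 0`.  Reduce to finitely many letters (`MvPolynomial.exists_fin_rename`); lift `x` to the
   ordered-word element `P = Σ_d x_d · X^d` of the free algebra `L⟨X_1..X_r⟩` (coefficients in `𝒪`;
   `P(T) = x(T) = 0` in every receptacle since the `T`'s commute); `heckeRelations_definedOverInt_holds`
   writes `P = Σ_i c_i · Q_i`, `c_i ∈ 𝒪`, `Q_i` integer relations of the system; projecting to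
   `L[X]` (`MvPolynomial.map_injective`) gives `x = Σ_i c_i · Q_i^{ab}` over `𝒪`, and `f` kills
   every `Q_i` by hypothesis.
2. *Abstract lifting lemma* (`exists_common_eigenvector_lifting_residual_system`): the kernel `𝔪̃`
   of `x ↦ x̄(f)` is a prime of `𝒪[X_Λ]` containing (by 1) the kernel of `ev : 𝒪[X_Λ] → A`;
   `Ideal.exists_le_prime_disjoint` gives a prime `𝔓 ⊂ A` with `ev⁻¹(𝔓) ⊆ 𝔪̃`; `A/𝔓 = L`
   (`IsAlgClosed.algebraMap_bijective_of_isIntegral`), so every `a ∈ A` is a scalar `μ_a` mod `𝔓`;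
   the valuation-ring unit trick gives `μ_{T_λ} ∈ 𝒪` with residue `f λ`; `A` is Artinian, so `𝔓`
   is a minimal prime and Step 2 of the tree's Deligne–Serre lemma [DeligneSerre1974, Lemme 6.11]
   (`Literature.Algebra.Module.DeligneSerre.exists_annihilator_eq_of_mem_minimalPrimes`) yields a
   non-zero `n ∈ N` with annihilator `𝔓` — a common eigenvector with eigenvalues `μ_{T_λ}`; for
   `N = A ⊆ E` any non-zero value `n_k(v) ∈ M_k` is the required class.  (The tree's assembled forms
   `DeligneSerre.deligneSerre_lifting*` are not applicable verbatim: `𝒪 = 𝒪_{ℚ̄_p}` is not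
   Noetherian and the residual character is only given on integral polynomial expressions.) -/

set_option linter.dupNamespace false

namespace Summit.Langlands.Langlands.Theorems.ClassicalCongruenceSplitJunction

open Literature.NumberTheory.Automorphic
open Literature.NumberTheory.Automorphic.ResGLnCohomology
open Literature.NumberTheory.GaloisRepresentations
/-! ## Ordered words and the ordered-word lift of a commutative polynomial -/
/-- Evaluating the ordered word `[0]^{d 0} ⋯ [r-1]^{d (r-1)}` of the free monoid on `Fin r` at
letters `h j` of a commutative monoid gives the monomial `∏ j, h j ^ d j`. -/
theorem freeMonoid_lift_orderedWord {r : ℕ} {B : Type*} [CommMonoid B] (h : Fin r → B)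
    (d : Fin r →₀ ℕ) :
    FreeMonoid.lift h (((List.finRange r).map fun j => FreeMonoid.of j ^ d j).prod) =
      ∏ j, h j ^ d j := by
  rw [map_list_prod, List.map_map, Fin.prod_univ_def]
  congr 2
  funext j
  simp only [Function.comp_apply, map_pow, FreeMonoid.lift_eval_of]

/-- The ordered-word lift `Σ_d q_d • X^d ∈ L⟨X_1, …, X_r⟩` of a commutative polynomial
`q ∈ 𝒪[X_1, …, X_r]` (`𝒪 ⊆ L` a valuation ring) evaluates, in any *commutative* `L`-algebra, to
the commutative evaluation of `q`. -/
theorem freeAlgebra_lift_orderedWordLift {L B : Type*} [Field L] [CommRing B] [Algebra L B]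
    (s : ValuationSubring L) {r : ℕ} (q : MvPolynomial (Fin r) s) (g : Fin r → B) :
    FreeAlgebra.lift L g (∑ d ∈ q.support, ((q.coeff d : s) : L) •
        (FreeMonoid.lift (FreeAlgebra.ι L)
          (((List.finRange r).map fun j => FreeMonoid.of j ^ d j).prod) : FreeAlgebra L (Fin r))) =
      MvPolynomial.eval₂ ((algebraMap L B).comp (algebraMap s L)) g q := by
  rw [map_sum, MvPolynomial.eval₂_eq']
  refine Finset.sum_congr rfl fun d _ => ?_
  rw [map_smul, freeAlgebra_lift_freeMonoidLift, freeMonoid_lift_orderedWord, Algebra.smul_def,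
    RingHom.comp_apply, ValuationSubring.algebraMap_apply]

/-- The coefficients (in the monoid-algebra model) of the ordered-word lift of a polynomial with
coefficients in a valuation ring `s ⊆ L` lie in `s`. -/
theorem coeff_orderedWordLift_mem {L : Type*} [Field L] (s : ValuationSubring L) {r : ℕ}
    (q : MvPolynomial (Fin r) s) (u : FreeMonoid (Fin r)) :
    (FreeAlgebra.equivMonoidAlgebraFreeMonoid (∑ d ∈ q.support, ((q.coeff d : s) : L) •
        (FreeMonoid.lift (FreeAlgebra.ι L)
          (((List.finRange r).map fun j => FreeMonoid.of j ^ d j).prod) :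
            FreeAlgebra L (Fin r)))).coeff u ∈ s := by
  classical
  rw [map_sum, MonoidAlgebra.coeff_sum, Finsupp.finsetSum_apply]
  refine sum_mem fun d _ => ?_
  rw [map_smul, equivMonoidAlgebraFreeMonoid_freeMonoidLift, MonoidAlgebra.of_apply,
    MonoidAlgebra.smul_single', mul_one, MonoidAlgebra.coeff_single, Finsupp.single_apply]
  split_ifs
  · exact SetLike.coe_mem _
  · exact zero_mem s

/-- The commutative image `Q^{ab} ∈ ℤ[X]` of `Q ∈ ℤ⟨X⟩`, evaluated in a commutative ring, is `Q(h)`. -/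
theorem eval₂_freeRingLift_X {r : ℕ} {B : Type*} [CommRing B] (h : Fin r → B)
    (Q : FreeRing (Fin r)) :
    MvPolynomial.eval₂ (Int.castRingHom B) h
        (FreeRing.lift (MvPolynomial.X : Fin r → MvPolynomial (Fin r) ℤ) Q) =
      FreeRing.lift h Q := by
  have hc : (MvPolynomial.eval₂Hom (Int.castRingHom B) h).comp
      (FreeRing.lift (MvPolynomial.X : Fin r → MvPolynomial (Fin r) ℤ)) = FreeRing.lift h :=
    FreeRing.hom_ext fun j => by simp
  exact DFunLike.congr_fun hc Q

/-- The projection `L⟨X⟩ → L[X]` sends the image of `Q ∈ ℤ⟨X⟩` to the base change of `Q^{ab}`. -/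
theorem freeAlgebra_lift_X_freeRingLift {L : Type*} [CommRing L] {r : ℕ} (Q : FreeRing (Fin r)) :
    FreeAlgebra.lift L (MvPolynomial.X : Fin r → MvPolynomial (Fin r) L)
        (FreeRing.lift (FreeAlgebra.ι L : Fin r → FreeAlgebra L (Fin r)) Q) =
      MvPolynomial.map (Int.castRingHom L)
        (FreeRing.lift (MvPolynomial.X : Fin r → MvPolynomial (Fin r) ℤ) Q) := by
  have hc : ((FreeAlgebra.lift L (MvPolynomial.X : Fin r → MvPolynomial (Fin r) L)).toRingHom).comp
        (FreeRing.lift (FreeAlgebra.ι L : Fin r → FreeAlgebra L (Fin r))) =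
      (MvPolynomial.map (Int.castRingHom L)).comp
        (FreeRing.lift (MvPolynomial.X : Fin r → MvPolynomial (Fin r) ℤ)) :=
    FreeRing.hom_ext fun j => by simp
  exact DFunLike.congr_fun hc Q

/-! ## The abstract lifting lemma (Deligne–Serre, commutative form over a valued closed field) -/
/-- **Deligne–Serre lifting lemma, abstract commutative form** (cf. [DeligneSerre1974, Lemme 6.11]
and the tree's `Literature.Algebra.Module.DeligneSerre.*`).  Let `L` be an algebraically closed
field with a valuation ring `𝒪 ⊆ L` (residue field `κ`), `A` a commutative finite-dimensional
`L`-algebra acting faithfully on a finite `A`-module `N`, `T : Λ → A` a family of elements and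
`f : Λ → κ` a *residual system of eigenvalues compatible with every integral polynomial relation
of `T`*: whenever `x ∈ 𝒪[X_Λ]` vanishes at `T`, its reduction vanishes at `f`.  Then there is a
non-zero `n ∈ N` which is a common eigenvector of the `T λ` with integral eigenvalues `μ_λ ∈ 𝒪`
reducing to `f λ`. -/
theorem exists_common_eigenvector_lifting_residual_system
    {L : Type*} [Field L] [IsAlgClosed L] (𝒪 : ValuationSubring L)
    {A : Type*} [CommRing A] [Algebra L A] [Module.Finite L A]
    {N : Type*} [AddCommGroup N] [Module A N] [Module.Finite A N]
    (hfaith : Module.annihilator A N = ⊥)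
    {Λ : Type*} (T : Λ → A) (f : Λ → IsLocalRing.ResidueField 𝒪)
    (hkey : ∀ x : MvPolynomial Λ 𝒪,
      MvPolynomial.eval₂ ((algebraMap L A).comp (algebraMap 𝒪 L)) T x = 0 →
      MvPolynomial.eval₂ (algebraMap 𝒪 (IsLocalRing.ResidueField 𝒪)) f x = 0) :
    ∃ n : N, n ≠ 0 ∧ ∀ a : Λ, ∃ μ : 𝒪,
      T a • n = algebraMap L A (μ : L) • n ∧ IsLocalRing.residue 𝒪 μ = f a := by
  classical
  -- the two evaluations of `𝒪[X_Λ]`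
  let ev : MvPolynomial Λ 𝒪 →+* A :=
    MvPolynomial.eval₂Hom ((algebraMap L A).comp (algebraMap 𝒪 L)) T
  let evf : MvPolynomial Λ 𝒪 →+* IsLocalRing.ResidueField 𝒪 :=
    MvPolynomial.eval₂Hom (algebraMap 𝒪 (IsLocalRing.ResidueField 𝒪)) f
  have hkey' : ∀ x, ev x = 0 → evf x = 0 := hkey
  have hevC : ∀ y : 𝒪, ev (MvPolynomial.C y) = algebraMap L A (y : L) := fun y => by
    simp only [ev, MvPolynomial.coe_eval₂Hom, MvPolynomial.eval₂_C, RingHom.comp_apply,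
      ValuationSubring.algebraMap_apply]
  have hevfC : ∀ y : 𝒪, evf (MvPolynomial.C y) = IsLocalRing.residue 𝒪 y := fun y => by
    simp only [evf, MvPolynomial.coe_eval₂Hom, MvPolynomial.eval₂_C]
    rfl
  haveI : (RingHom.ker evf).IsPrime := RingHom.ker_isPrime evf
  -- `A` is Artinian and Noetherian
  haveI : IsArtinianRing A := IsArtinianRing.of_finite L A
  haveI : IsNoetherianRing A := isNoetherian_of_tower L (inferInstance : IsNoetherian L A)
  -- a prime `𝔓` of `A` whose preimage lies in the prime `ker evf`
  obtain ⟨𝔓, h𝔓, -, h𝔓S⟩ := Ideal.exists_le_prime_disjoint (⊥ : Ideal A)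
    ((RingHom.ker evf).primeCompl.map ev) (by
      rw [Set.disjoint_left]
      rintro a ha ⟨x, hx, rfl⟩
      have h0 : ev x = 0 := by simpa using ha
      exact hx ((RingHom.mem_ker).2 (hkey' x h0)))
  have hcomap : ∀ x, ev x ∈ 𝔓 → evf x = 0 := by
    intro x hx
    by_contra h
    exact Set.disjoint_left.1 h𝔓S hx ⟨x, fun hk => h ((RingHom.mem_ker).1 hk), rfl⟩
  haveI := h𝔓
  -- `A/𝔓 = L`: every element of `A` is a scalar modulo `𝔓`
  have hscalar : ∀ a : A, ∃ μ : L, a - algebraMap L A μ ∈ 𝔓 := by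
    intro a
    haveI : Module.Finite L (A ⧸ 𝔓) :=
      Module.Finite.of_surjective (Ideal.Quotient.mkₐ L 𝔓).toLinearMap
        (Ideal.Quotient.mkₐ_surjective L 𝔓)
    haveI : Algebra.IsIntegral L (A ⧸ 𝔓) := Algebra.IsIntegral.of_finite L _
    obtain ⟨μ, hμ⟩ :=
      (IsAlgClosed.algebraMap_bijective_of_isIntegral (k := L) (K := A ⧸ 𝔓)).2
        (Ideal.Quotient.mk 𝔓 a)
    refine ⟨μ, ?_⟩
    rw [← Ideal.Quotient.eq, ← hμ]
    rfl
  -- the unit trick: a scalar congruent to an integral polynomial in `T` is integral, and its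
  -- residue is the reduction of the polynomial at `f`
  have hint : ∀ (x : MvPolynomial Λ 𝒪) (μ : L), ev x - algebraMap L A μ ∈ 𝔓 →
      ∃ μ' : 𝒪, (μ' : L) = μ ∧ IsLocalRing.residue 𝒪 μ' = evf x := by
    intro x μ hx
    have hμ : μ ∈ 𝒪 := by
      by_contra hμ
      have hμ0 : μ ≠ 0 := by
        rintro rfl
        exact hμ (zero_mem 𝒪)
      have hinv : μ⁻¹ ∈ 𝒪 := (𝒪.mem_or_inv_mem μ).resolve_left hμ
      -- `μ⁻¹` is a non-unit of `𝒪`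
      have hres : IsLocalRing.residue 𝒪 ⟨μ⁻¹, hinv⟩ = 0 := by
        rw [IsLocalRing.residue_eq_zero_iff, IsLocalRing.mem_maximalIdeal, mem_nonunits_iff]
        intro hu
        obtain ⟨w, hw⟩ := hu.exists_right_inv
        have hw' : μ⁻¹ * (w : L) = 1 := by
          have := congrArg (fun z : 𝒪 => (z : L)) hw
          simpa using this
        have hμw : μ = (w : L) := by
          rw [← inv_inv μ, inv_eq_of_mul_eq_one_right hw']
        exact hμ (hμw ▸ w.2)
      -- the polynomial `μ⁻¹ • x - 1` maps into `𝔓`, but reduces to `-1`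
      have hx' : ev (MvPolynomial.C ⟨μ⁻¹, hinv⟩ * x - 1) ∈ 𝔓 := by
        have : ev (MvPolynomial.C ⟨μ⁻¹, hinv⟩ * x - 1) =
            algebraMap L A μ⁻¹ * (ev x - algebraMap L A μ) := by
          rw [map_sub, map_mul, map_one, hevC, mul_sub, ← map_mul, inv_mul_cancel₀ hμ0, map_one]
        rw [this]
        exact 𝔓.mul_mem_left _ hx
      have := hcomap _ hx'
      rw [map_sub, map_mul, map_one, hevfC, hres, zero_mul, zero_sub, neg_eq_zero] at this
      exact one_ne_zero this
    refine ⟨⟨μ, hμ⟩, rfl, ?_⟩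
    have hx' : ev (x - MvPolynomial.C ⟨μ, hμ⟩) ∈ 𝔓 := by
      rw [map_sub, hevC]
      exact hx
    have := hcomap _ hx'
    rw [map_sub, hevfC, sub_eq_zero] at this
    exact this.symm
  -- Step 2 of [DeligneSerre1974, Lemme 6.11] (tree): `𝔓` is a minimal prime (`A` is Artinian),
  -- hence the exact annihilator of some `n ≠ 0`
  obtain ⟨n, hn⟩ := Literature.Algebra.Module.DeligneSerre.exists_annihilator_eq_of_mem_minimalPrimes
    hfaith (IsArtinianRing.mem_minimalPrimes (p := 𝔓) bot_le)
  refine ⟨n, Literature.Algebra.Module.DeligneSerre.ne_zero_of_annihilator_eq h𝔓.ne_top hn,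
    fun a => ?_⟩
  obtain ⟨μ, hμ⟩ := hscalar (T a)
  have hXa : ev (MvPolynomial.X a) = T a := by simp [ev]
  obtain ⟨μ', hμ'μ, hres⟩ := hint (MvPolynomial.X a) μ (by rwa [hXa])
  refine ⟨μ', ?_, ?_⟩
  · have := (hn _).2 hμ
    rwa [sub_smul, sub_eq_zero, ← hμ'μ] at this
  · rw [hres]
    simp [evf]

/-! ## Main theorem -/
/-- **The classical congruence junction** (`ClassicalCongruenceSplit.ClassicalCongruenceJunction`):
a residual system of Hecke eigenvalues `f` away from `S ∪ supp 𝔫`, compatible with every integer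
polynomial relation among the good Hecke operators of a parallel-weight system of level `𝔫`,
is the reduction of the eigenvalue system of a genuine non-zero characteristic-zero class `c` in
one of the receptacles of the system. -/
theorem classicalCongruenceJunction :
    Summit.Langlands.Langlands.Theses.ClassicalCongruenceSplit.ClassicalCongruenceJunction := by
  intro p _ F _ _ S 𝔫 m lams qs h𝔫 hpar f hf
  classical
  -- (0) the receptacles are finite-dimensional (Borel–Serre)
  haveI hfd : ∀ k : Fin m, FiniteDimensional (PadicAlgCl p)
      (levelCohomology (PadicAlgCl p) 2 F 𝔫 (lams k) (qs k)) := fun k =>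
    finiteDimensional_levelCohomology_of_borelSerre'
      BorelSerre1973_finiteDimensional_groupCohomology_congruenceSubgroup_holds
      (PadicAlgCl p) 2 F 𝔫 h𝔫 (lams k) (qs k)
  -- integers of `ℚ̄_p` = elements of norm at most one
  have hOint : ∀ x : PadicAlgCl p, x ∈ padicAlgClIntegers p ↔ ‖x‖ ≤ 1 := fun x => by
    change Valued.v x ≤ 1 ↔ _
    rw [← NNReal.coe_le_coe, PadicAlgCl.valuation_coe, NNReal.coe_one]
  -- (1) the commuting family of good Hecke operators in `E = Π_k End (M k)`
  let T : {vi : IsDedekindDomain.HeightOneSpectrum (NumberField.RingOfIntegers F) × ℕ //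
        vi.1 ∉ S ∧ ¬ vi.1.asIdeal ∣ 𝔫} →
      (Π k : Fin m, Module.End (PadicAlgCl p)
        (levelCohomology (PadicAlgCl p) 2 F 𝔫 (lams k) (qs k))) :=
    fun a k => heckeT (PadicAlgCl p) 2 F 𝔫 (lams k) (qs k) a.1.1 a.1.2
  have hcomm : ∀ x ∈ Set.range T, ∀ y ∈ Set.range T, x * y = y * x := by
    rintro _ ⟨a, rfl⟩ _ ⟨b, rfl⟩
    funext k
    exact heckeT_comm (PadicAlgCl p) 2 F h𝔫 (lams k) (qs k) a.2.2 b.2.2 a.1.2 b.1.2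
  letI : CommRing (Algebra.adjoin (PadicAlgCl p) (Set.range T)) :=
    { (inferInstance : Ring (Algebra.adjoin (PadicAlgCl p) (Set.range T))) with
      mul_comm := (Algebra.isMulCommutative_adjoin (PadicAlgCl p) hcomm).is_comm.comm }
  haveI : Module.Finite (PadicAlgCl p) (Algebra.adjoin (PadicAlgCl p) (Set.range T)) :=
    Module.Finite.of_injective (Algebra.adjoin (PadicAlgCl p) (Set.range T)).val.toLinearMap
      Subtype.val_injective
  -- `A` acts faithfully on itself
  have hfaith : Module.annihilator (Algebra.adjoin (PadicAlgCl p) (Set.range T))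
      (Algebra.adjoin (PadicAlgCl p) (Set.range T)) = ⊥ := by
    rw [Submodule.eq_bot_iff]
    intro a ha
    simpa using Module.mem_annihilator.1 ha 1
  -- (2) the key transfer: integral polynomial relations of `T` hold for `f`
  have hkey : ∀ x : MvPolynomial {vi : IsDedekindDomain.HeightOneSpectrum
        (NumberField.RingOfIntegers F) × ℕ // vi.1 ∉ S ∧ ¬ vi.1.asIdeal ∣ 𝔫} (padicAlgClIntegers p),
      MvPolynomial.eval₂ ((algebraMap (PadicAlgCl p) (Algebra.adjoin (PadicAlgCl p) (Set.range T))).comp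
          (algebraMap (padicAlgClIntegers p) (PadicAlgCl p)))
        (fun a => (⟨T a, Algebra.subset_adjoin ⟨a, rfl⟩⟩ : Algebra.adjoin (PadicAlgCl p) (Set.range T))) x = 0 →
      MvPolynomial.eval₂ (algebraMap (padicAlgClIntegers p) (padicAlgClResidueField p))
        (fun a => f a.1.1 a.1.2) x = 0 := by
    intro x hx
    obtain ⟨r, ix, -, q, rfl⟩ := MvPolynomial.exists_fin_rename x
    rw [MvPolynomial.eval₂_rename] at hx ⊢
    -- the ordered-word lift `P` of `q`
    have hint : ∀ u, ‖(FreeAlgebra.equivMonoidAlgebraFreeMonoid (∑ d ∈ q.support,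
        ((q.coeff d : padicAlgClIntegers p) : PadicAlgCl p) •
          (FreeMonoid.lift (FreeAlgebra.ι (PadicAlgCl p))
            (((List.finRange r).map fun j => FreeMonoid.of j ^ d j).prod) :
              FreeAlgebra (PadicAlgCl p) (Fin r)))).coeff u‖ ≤ 1 := fun u =>
      (hOint _).1 (coeff_orderedWordLift_mem (padicAlgClIntegers p) q u)
    have hrel : ∀ k : Fin m, FreeAlgebra.lift (PadicAlgCl p)
        (fun j => heckeT (PadicAlgCl p) 2 F 𝔫 (lams k) (qs k) (ix j).1.1 (ix j).1.2)
        (∑ d ∈ q.support, ((q.coeff d : padicAlgClIntegers p) : PadicAlgCl p) •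
          (FreeMonoid.lift (FreeAlgebra.ι (PadicAlgCl p))
            (((List.finRange r).map fun j => FreeMonoid.of j ^ d j).prod) :
              FreeAlgebra (PadicAlgCl p) (Fin r))) = 0 := by
      intro k
      have hfac : FreeAlgebra.lift (PadicAlgCl p)
          (fun j => heckeT (PadicAlgCl p) 2 F 𝔫 (lams k) (qs k) (ix j).1.1 (ix j).1.2) =
          ((Pi.evalAlgHom (PadicAlgCl p) (fun k : Fin m => Module.End (PadicAlgCl p)
              (levelCohomology (PadicAlgCl p) 2 F 𝔫 (lams k) (qs k))) k).comp
            (Algebra.adjoin (PadicAlgCl p) (Set.range T)).val).comp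
          (FreeAlgebra.lift (PadicAlgCl p) (fun j => (⟨T (ix j), Algebra.subset_adjoin ⟨ix j, rfl⟩⟩ :
            Algebra.adjoin (PadicAlgCl p) (Set.range T)))) := by
        refine FreeAlgebra.hom_ext (funext fun j => ?_)
        simp [T]
      rw [hfac, AlgHom.comp_apply, freeAlgebra_lift_orderedWordLift]
      exact (congrArg _ hx).trans (map_zero _)
    obtain ⟨m', c, Q, hc, hQ, hPQ⟩ := heckeRelations_definedOverInt_holds 2 F p 𝔫 h𝔫 m lams qs
      hpar r (fun j => (ix j).1) (fun j => (ix j).2.2) _ hint hrel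
    -- `f` satisfies the integer relations `Q i`
    have hfQ : ∀ i, FreeRing.lift ((fun a : {vi : IsDedekindDomain.HeightOneSpectrum
        (NumberField.RingOfIntegers F) × ℕ // vi.1 ∉ S ∧ ¬ vi.1.asIdeal ∣ 𝔫} => f a.1.1 a.1.2) ∘ ix)
        (Q i) = 0 :=
      fun i => hf r (fun j => (ix j).1) (fun j => (ix j).2) (Q i) (hQ i)
    -- comparison in `L[X_1, …, X_r]`: `q = Σ_i c_i • (Q i)^{ab}` over `𝒪`
    have hq : MvPolynomial.map (algebraMap (padicAlgClIntegers p) (PadicAlgCl p)) q =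
        MvPolynomial.map (algebraMap (padicAlgClIntegers p) (PadicAlgCl p))
          (∑ i, MvPolynomial.C (⟨c i, (hOint _).2 (hc i)⟩ : padicAlgClIntegers p) *
            MvPolynomial.map (Int.castRingHom (padicAlgClIntegers p))
              (FreeRing.lift (MvPolynomial.X : Fin r → MvPolynomial (Fin r) ℤ) (Q i))) := by
      have h1 := congrArg (FreeAlgebra.lift (PadicAlgCl p)
        (MvPolynomial.X : Fin r → MvPolynomial (Fin r) (PadicAlgCl p))) hPQ
      rw [freeAlgebra_lift_orderedWordLift, MvPolynomial.algebraMap_eq, ← MvPolynomial.coe_eval₂Hom,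
        ← MvPolynomial.map_eq_eval₂Hom_C_comp, map_sum] at h1
      simp_rw [map_smul, freeAlgebra_lift_X_freeRingLift] at h1
      rw [h1, map_sum]
      refine Finset.sum_congr rfl fun i _ => ?_
      rw [map_mul, MvPolynomial.map_C, MvPolynomial.map_map, MvPolynomial.smul_eq_C_mul,
        ValuationSubring.algebraMap_apply,
        RingHom.ext_int ((algebraMap (padicAlgClIntegers p) (PadicAlgCl p)).comp
          (Int.castRingHom (padicAlgClIntegers p))) (Int.castRingHom (PadicAlgCl p))]
    replace hq := MvPolynomial.map_injective (algebraMap (padicAlgClIntegers p) (PadicAlgCl p))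
      (fun a b h => Subtype.ext (by
        rwa [ValuationSubring.algebraMap_apply, ValuationSubring.algebraMap_apply] at h)) hq
    rw [hq, ← MvPolynomial.coe_eval₂Hom, map_sum]
    refine Finset.sum_eq_zero fun i _ => ?_
    rw [map_mul, MvPolynomial.coe_eval₂Hom, MvPolynomial.eval₂_C, MvPolynomial.eval₂_map,
      RingHom.ext_int ((algebraMap (padicAlgClIntegers p) (padicAlgClResidueField p)).comp
        (Int.castRingHom (padicAlgClIntegers p))) (Int.castRingHom _),
      eval₂_freeRingLift_X, hfQ i, mul_zero]
  -- (3) the abstract lifting lemma, applied to `A` acting on itself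
  obtain ⟨n, hn, hTn⟩ := exists_common_eigenvector_lifting_residual_system
    (padicAlgClIntegers p) hfaith
    (fun a => (⟨T a, Algebra.subset_adjoin ⟨a, rfl⟩⟩ : Algebra.adjoin (PadicAlgCl p) (Set.range T)))
    (fun a => f a.1.1 a.1.2) hkey
  choose μ hμ using hTn
  -- a non-zero value `c = n_k v` of the common eigen-element `n ∈ A ⊆ Π_k End (M k)`
  have hnE : (n : Π k : Fin m, Module.End (PadicAlgCl p)
      (levelCohomology (PadicAlgCl p) 2 F 𝔫 (lams k) (qs k))) ≠ 0 :=
    fun h => hn (ZeroMemClass.coe_eq_zero.1 h)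
  obtain ⟨k, hk⟩ := Function.ne_iff.1 hnE
  obtain ⟨v, hv⟩ : ∃ v, (n : Π k : Fin m, Module.End (PadicAlgCl p)
      (levelCohomology (PadicAlgCl p) 2 F 𝔫 (lams k) (qs k))) k v ≠ 0 := by
    by_contra h
    push Not at h
    exact hk (LinearMap.ext fun w => by simpa using h w)
  refine ⟨k, fun w i => if h : w ∉ S ∧ ¬ w.asIdeal ∣ 𝔫 then μ ⟨(w, i), h⟩ else 0, _, hv,
    fun w hwS hw𝔫 i => ?_⟩
  dsimp only
  rw [dif_pos ⟨hwS, hw𝔫⟩]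
  refine ⟨?_, (hμ ⟨(w, i), hwS, hw𝔫⟩).2⟩
  have := congrArg (fun a : Algebra.adjoin (PadicAlgCl p) (Set.range T) =>
    (a : Π k : Fin m, Module.End (PadicAlgCl p)
      (levelCohomology (PadicAlgCl p) 2 F 𝔫 (lams k) (qs k))) k v) (hμ ⟨(w, i), hwS, hw𝔫⟩).1
  simpa [T, smul_eq_mul] using this

end Summit.Langlands.Langlands.Theorems.ClassicalCongruenceSplitJunction
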